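import Literature.Geometry.Riemannian.MetricFlowFiniteTimeSubconvergenceAux2
import Literature.Geometry.Riemannian.MetricFlowFiniteTimeSubconvergenceAux4
import Literature.Geometry.Riemannian.MetricFlowFConvergenceMeasures
import HarnessLib

/-!
# Subconvergence within a correspondence over a finite set of times (Bamler 2023, §7.3,
# Lemma 7.? (arXiv v1 Lemma 161)), modulo Claim 7.? (arXiv v1 Claim 162)

R. Bamler, *Compactness theory of the space of super Ricci flows*, Invent. Math. 233 (2023), §7.3,
Lemma (arXiv v1 Lemma 161): *"Fix some `H, V ≥ 0`, `r > 0`, a function `b : (0,1] → (0,1]` and a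
finite subset `I₀ ⊂ I ⊂ ℝ` of an interval. Consider a sequence of metric flow pairs
`(𝒳ⁱ, (μⁱ_t)_{t ∈ I})` representing classes in `𝔽_I^I(H, V, b, r)`, `i = 1, 2, …`. Then, after
passing to a subsequence, we can find a correspondence `ℭ₀` between the metric flows `𝒳ⁱ` over
`I₀` that is also fully defined over `I₀` such that the metric flow pairs `(𝒳ⁱ, (μⁱ_t)_{t ∈ I})`
form Cauchy sequence within `ℭ₀` uniformly over `I₀`, i.e. for any `ε > 0` we have
`d_𝔽^{ℭ₀, I₀}((𝒳ⁱ, (μⁱ_t)), (𝒳ʲ, (μʲ_t))) ≤ ε` for large `i, j`."*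

This file proves the Lemma in the tree's vocabulary (`MetricFlowPair`, `FamilyCorrespondence`,
`FDistAdmissibleWith`) for `H`-concentrated metric flow pairs `P n` over `[a, T]`, defined over
`(a, T)` (`Ioo a T ⊆ (P n).I'`), with `Var(μⁿ_t) ≤ V` (the membership in `𝔽(H, V, b, r)` is only used
through these bounds: the mass-distribution bound `b` of the slices follows from them by
Prop. 4.1, `IsHConcentrated.isMVb_slice`) and a finite `I₀ ⊆ (a, T)`, MODULO the subsequential
Claim 7.? (arXiv v1 Claim 162), taken as the hypothesis `h162` in the abstract form
`exists_subseq_tendsto_map_kernel` (`MetricFlowKernelSubconvergence.lean`, proved separately):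

* `MetricFlowPair.exists_subseq_familyCorrespondence_finite` — **Lemma 7.? (arXiv v1 Lemma 161)**:
  a subsequence `φ` and a correspondence `ℭ₀` over `I₀` between the flows `𝒳^{φ n}`, fully defined
  over `I₀`, such that for every `ε > 0`, for large `i, j`, the radius `ε` is admissible for
  `d_𝔽^{ℭ₀, I₀}(P (φ i), P (φ j))` with the empty exceptional set (so `d_𝔽^{ℭ₀, I₀} ≤ ε`).

Proof, following the source: STEP 1–2 (`exists_subseq_familyCorrespondence_tendsto`, (7.20)): common
Polish comparison spaces `Z_t` with `(φⁿ_t)_* μⁿ_t → m_t` in `W₁`; STEP 3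
(`exists_subseq_limit_kernels`, Claim 162 = `h162` at all base points after a diagonal
subsequence, (7.22)): `1`-Lipschitz limit kernels `K_{s,t} : supp m_t → 𝒫(Z_s)`; the couplings
`qⁿ_t` of `μⁿ_t` and `m_t|_{supp m_t}` with `∫ d(φⁿ_t x, y) dqⁿ_t → 0` ((7.21),
`exists_isCoupling_supportMeasure_lintegral_le`); STEP 4 (Claim 163 and the display after it,
`tendsto_lintegral_wassersteinW1_kernel`): `∫ d_{W₁}((φⁿ_s)_* νⁿ_{x;s}, K_{s,t}(y)) dqⁿ_t(x, y) → 0`;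
STEP 5 (*"As in the proof of Proposition 5.14 … we can construct a coupling `q^{i,j}_{t_k}` between
`μⁱ_{t_k}, μʲ_{t_k}`"*, `IsCoupling.exists_glue_lintegral_le`): glue `qⁱ_t`, `qʲ_t` along
`m_t|_{supp m_t}` and integrate the triangle inequality in `𝒫(Z_s)` (`kernelDistWithin_le_add`,
`kernelDistWithin_self_le` for `s = t`).

Everything is proved (modulo the hypothesis `h162`); no definitions, no named facts.

## References

* R. H. Bamler, *Compactness theory of the space of super Ricci flows*, Invent. Math. 233 (2023),
  1121–1277 (arXiv:2008.09298), §7.3, Lemma 7.? (arXiv v1 Lemma 161), Claims 7.? (arXiv v1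
  Claims 162, 163), (7.20)–(7.22); §5.2, Prop. 5.14. [Bamler2023]
-/

noncomputable section

open Set MeasureTheory Filter TopologicalSpace Function
open scoped Topology ENNReal NNReal

namespace Literature.Geometry.Riemannian

universe u

namespace MetricFlowPair

open MetricFlow

variable {I₁ I₂ I'' : Set ℝ} {P₁ : MetricFlowPair.{u} I₁} {P₂ : MetricFlowPair.{u} I₂}

/-! ### Pointwise bounds for the integrand of the `𝔽`-distance -/

/-- **The integrand at `s = t` is a distance of points**: `d_{W₁}((φ¹_t)_* ν¹_{x¹;t}, (φ²_t)_* ν²_{x²;t})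
= d_{W₁}(δ_{φ¹_t x¹}, δ_{φ²_t x²}) ≤ d(φ¹_t x¹, z) + d(φ²_t x², z)` for every `z ∈ Z_t` (item (5) of
Def. 3.2 and `wassersteinW1_dirac_dirac_le`; the case *"the claim is trivial in the case `l = k`"*
of Bamler's Claim 162). [cite: Bamler2023, §7.3, Lemma 7.? (arXiv v1 Lemma 161), proof] -/
theorem kernelDistWithin_self_le (ℭ : Correspondence₂ P₁.flow P₂.flow I'') {t : ℝ} (ht₁ : t ∈ ℭ.dom₁)
    (ht₂ : t ∈ ℭ.dom₂)
    (p : P₁.flow.Slice ⟨t, (ℭ.dom₁_subset ht₁).1⟩ × P₂.flow.Slice ⟨t, (ℭ.dom₂_subset ht₂).1⟩)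
    (z : ℭ.Z ⟨t, (ℭ.dom₁_subset ht₁).2⟩) :
    kernelDistWithin P₁ P₂ ℭ ht₁ ht₂ ht₁ ht₂ p ≤ edist (ℭ.φ₁ t ht₁ p.1) z + edist (ℭ.φ₂ t ht₂ p.2) z := by
  unfold kernelDistWithin
  rw [P₁.flow.condKernel_self, P₂.flow.condKernel_self,
    Measure.map_dirac' (ℭ.isometry₁ t ht₁).continuous.measurable,
    Measure.map_dirac' (ℭ.isometry₂ t ht₂).continuous.measurable]
  exact (wassersteinW1_dirac_dirac_le _ _).trans (edist_triangle_right _ _ _)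

/-- **The triangle inequality in `𝒫(Z_s)` through a third measure**:
`d_{W₁}((φ¹_s)_* ν¹_{x¹;s}, (φ²_s)_* ν²_{x²;s}) ≤ d_{W₁}((φ¹_s)_* ν¹_{x¹;s}, ν) + d_{W₁}((φ²_s)_* ν²_{x²;s}, ν)`
for `s ≤ t` and any measure `ν` on the (complete separable) comparison space `Z_s` (Bamler 2023,
§7.3, last step of the proof of Lemma 7.?, with `ν = (φ^∞_s)_* ν^∞_{y;s}`).
[cite: Bamler2023, §7.3, Lemma 7.? (arXiv v1 Lemma 161), proof] -/
theorem kernelDistWithin_le_add (ℭ : Correspondence₂ P₁.flow P₂.flow I'') {s t : ℝ}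
    (hs₁ : s ∈ ℭ.dom₁) (hs₂ : s ∈ ℭ.dom₂) (ht₁ : t ∈ ℭ.dom₁) (ht₂ : t ∈ ℭ.dom₂) (hst : s ≤ t)
    [SecondCountableTopology (ℭ.Z ⟨s, (ℭ.dom₁_subset hs₁).2⟩)]
    [CompleteSpace (ℭ.Z ⟨s, (ℭ.dom₁_subset hs₁).2⟩)]
    (p : P₁.flow.Slice ⟨t, (ℭ.dom₁_subset ht₁).1⟩ × P₂.flow.Slice ⟨t, (ℭ.dom₂_subset ht₂).1⟩)
    (ν : Measure (ℭ.Z ⟨s, (ℭ.dom₁_subset hs₁).2⟩)) :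
    kernelDistWithin P₁ P₂ ℭ hs₁ hs₂ ht₁ ht₂ p ≤
      wassersteinW1 ((P₁.flow.condKernel p.1 ⟨s, (ℭ.dom₁_subset hs₁).1⟩).map (ℭ.φ₁ s hs₁)) ν +
        wassersteinW1 ((P₂.flow.condKernel p.2 ⟨s, (ℭ.dom₂_subset hs₂).1⟩).map (ℭ.φ₂ s hs₂)) ν := by
  haveI := P₁.flow.isProbabilityMeasure_condKernel (s := ⟨s, (ℭ.dom₁_subset hs₁).1⟩) p.1 hst
  haveI := P₂.flow.isProbabilityMeasure_condKernel (s := ⟨s, (ℭ.dom₂_subset hs₂).1⟩) p.2 hst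
  haveI : IsProbabilityMeasure
      ((P₁.flow.condKernel p.1 ⟨s, (ℭ.dom₁_subset hs₁).1⟩).map (ℭ.φ₁ s hs₁)) :=
    Measure.isProbabilityMeasure_map (ℭ.isometry₁ s hs₁).continuous.measurable.aemeasurable
  haveI : IsProbabilityMeasure
      ((P₂.flow.condKernel p.2 ⟨s, (ℭ.dom₂_subset hs₂).1⟩).map (ℭ.φ₂ s hs₂)) :=
    Measure.isProbabilityMeasure_map (ℭ.isometry₂ s hs₂).continuous.measurable.aemeasurable
  calc kernelDistWithin P₁ P₂ ℭ hs₁ hs₂ ht₁ ht₂ p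
      ≤ wassersteinW1 ((P₁.flow.condKernel p.1 ⟨s, (ℭ.dom₁_subset hs₁).1⟩).map (ℭ.φ₁ s hs₁)) ν +
          wassersteinW1 ν ((P₂.flow.condKernel p.2 ⟨s, (ℭ.dom₂_subset hs₂).1⟩).map (ℭ.φ₂ s hs₂)) :=
        wassersteinW1_triangle _ _ _
    _ = _ := by rw [wassersteinW1_comm ν]

/-! ### Lemma 7.? (arXiv v1 Lemma 161) -/

/-- **Bamler 2023, §7.3, Lemma 7.? (arXiv v1 Lemma 161): subconvergence within a correspondence
over a finite set of times**, modulo Claim 7.? (arXiv v1 Claim 162) (`h162`, the statement of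
`exists_subseq_tendsto_map_kernel`). For `H`-concentrated metric flow pairs `P n` over `[a, T]`,
defined over `(a, T)`, with `Var(μⁿ_t) ≤ V`, and a finite `I₀ ⊆ (a, T)`: after passing to a
subsequence `φ` there is a correspondence `ℭ₀` between the flows `𝒳^{φ n}` over `I₀`, fully defined
over `I₀`, within which the pairs form a Cauchy sequence uniformly over `I₀` — for every `ε > 0`,
for large `i, j`, the radius `ε` is admissible for `d_𝔽^{ℭ₀, I₀}(P (φ i), P (φ j))` with `E = ∅`.
See the module docstring for the proof. (The compactness of the slices is not used.)
[cite: Bamler2023, §7.3, Lemma 7.? (arXiv v1 Lemma 161), Claims 162–163] -/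
theorem exists_subseq_familyCorrespondence_finite
    (h162 : ∀ {Zk Zl : Type u} [MetricSpace Zk] [MeasurableSpace Zk] [BorelSpace Zk]
      [SecondCountableTopology Zk] [CompleteSpace Zk] [MetricSpace Zl] [MeasurableSpace Zl]
      [BorelSpace Zl] [SecondCountableTopology Zl] [CompleteSpace Zl] {Xk Xl : ℕ → Type u}
      [∀ n, MetricSpace (Xk n)] [∀ n, MeasurableSpace (Xk n)] [∀ n, BorelSpace (Xk n)]
      [∀ n, SecondCountableTopology (Xk n)] [∀ n, MetricSpace (Xl n)]
      [∀ n, MeasurableSpace (Xl n)] [∀ n, BorelSpace (Xl n)] [∀ n, SecondCountableTopology (Xl n)]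
      [∀ n, CompleteSpace (Xl n)] (φk : ∀ n, Xk n → Zk) (φl : ∀ n, Xl n → Zl)
      (hφk : ∀ n, Isometry (φk n)) (hφl : ∀ n, Isometry (φl n))
      (κ : ∀ n, Xk n → Measure (Xl n)) [∀ n x, IsProbabilityMeasure (κ n x)] {L : ℝ≥0} {W : ℝ}
      (hgrad : ∀ n (v : Xl n → ℝ), Measurable v → (∀ y, v y ∈ Icc (0 : ℝ) 1) →
        (∃ c, ∀ x, ∫ y, v y ∂κ n x = c) ∨
          ∃ f : Xk n → ℝ, LipschitzWith L f ∧ ∀ x, ∫ y, v y ∂κ n x = MetricFlow.Phi (f x))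
      (hvar : ∀ n x, variance (κ n x) (κ n x) ≤ ENNReal.ofReal W) (μk : ∀ n, Measure (Xk n))
      (μl : ∀ n, Measure (Xl n)) [∀ n, IsProbabilityMeasure (μk n)]
      [∀ n, IsProbabilityMeasure (μl n)]
      (hchf : ∀ n (f : Xl n → ℝ≥0∞), Measurable f →
        ∫⁻ y, f y ∂μl n = ∫⁻ x, ∫⁻ y, f y ∂κ n x ∂μk n)
      (mk : Measure Zk) (ml : Measure Zl) [IsProbabilityMeasure mk] [IsProbabilityMeasure ml]
      (hmk : Tendsto (fun n ↦ wassersteinW1 ((μk n).map (φk n)) mk) atTop (𝓝 0))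
      (hml : Tendsto (fun n ↦ wassersteinW1 ((μl n).map (φl n)) ml) atTop (𝓝 0)) {x : Zk}
      (hx : x ∈ mk.support) (xn : ∀ n, Xk n) (hxn : Tendsto (fun n ↦ φk n (xn n)) atTop (𝓝 x)),
      ∃ ψ : ℕ → ℕ, StrictMono ψ ∧ ∃ ν : Measure Zl, IsProbabilityMeasure ν ∧
        ν.support ⊆ ml.support ∧
        Tendsto (fun n ↦ wassersteinW1 ((κ (ψ n) (xn (ψ n))).map (φl (ψ n))) ν) atTop (𝓝 0))
    {a T H V : ℝ} (hH : 0 ≤ H) (hV : 0 ≤ V) (P : ℕ → MetricFlowPair.{u} (Icc a T))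
    (hP : ∀ n, (P n).flow.IsHConcentrated H) (hI : ∀ n, Ioo a T ⊆ (P n).I')
    (hvar : ∀ n (t : (P n).I'), variance ((P n).μ t) ((P n).μ t) ≤ ENNReal.ofReal V)
    (hcpt : ∀ n (t : (P n).I'), CompactSpace ((P n).flow.Slice t))
    (I₀ : Finset ℝ) (hI₀ : (↑I₀ : Set ℝ) ⊆ Ioo a T) :
    ∃ φ : ℕ → ℕ, StrictMono φ ∧
      ∃ ℭ₀ : FamilyCorrespondence (fun n ↦ (P (φ n)).flow) (↑I₀ : Set ℝ),
        ℭ₀.FullyDefinedOver ↑I₀ ∧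
        ∀ ε : ℝ, 0 < ε → ∃ N, ∀ i ≥ N, ∀ j ≥ N,
          FDistAdmissibleWith (P (φ i)) (P (φ j)) (ℭ₀.pair i j) ∅ ↑I₀ ε := by
  have _ := hH
  have _ := hV
  have _ := hcpt
  classical
  haveI : ∀ n (t : (P n).I'), SecondCountableTopology ((P n).flow.Slice t) := fun n t ↦
    UniformSpace.secondCountable_of_separable _
  haveI : ∀ n (t : (P n).I'), IsProbabilityMeasure ((P n).μ t) := fun n t ↦
    isProbabilityMeasure_μ _ _
  -- STEP 1–2: common comparison spaces, (7.20)
  obtain ⟨φ₁, hφ₁, ℭ, hfull, hsc, hcs, m, hmP, hmV, hconv⟩ :=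
    exists_subseq_familyCorrespondence_tendsto P hP hI hvar I₀ hI₀
  haveI := hsc
  haveI := hcs
  haveI := hmP
  -- STEP 3: Claim 162 at all base points, (7.22)
  obtain ⟨ψ, hψ, hB⟩ := exists_subseq_limit_kernels @h162 (fun n ↦ P (φ₁ n)) (fun n ↦ hP (φ₁ n))
    I₀.countable_toSet ℭ hfull m hconv
  choose K D xD hKP hKL hDd hxD hlim using hB
  -- the couplings (7.21) with the support spaces of the limit measures
  have hq : ∀ (t : ℝ) (ht : t ∈ (↑I₀ : Set ℝ)) (n : ℕ),
      ∃ q : Measure ((P (φ₁ (ψ n))).flow.Slice ⟨t, (ℭ.dom_subset (ψ n) (hfull (ψ n) ht)).1⟩ ×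
        (m ⟨t, ht⟩).support),
        IsCoupling ((P (φ₁ (ψ n))).μ ⟨t, (ℭ.dom_subset (ψ n) (hfull (ψ n) ht)).1⟩)
          (supportMeasure (m ⟨t, ht⟩)) q ∧
        ∫⁻ p, edist (ℭ.φ (ψ n) t (hfull (ψ n) ht) p.1) (p.2 : ℭ.Z ⟨t, ht⟩) ∂q ≤
          wassersteinW1 (((P (φ₁ (ψ n))).μ ⟨t, (ℭ.dom_subset (ψ n) (hfull (ψ n) ht)).1⟩).map
            (ℭ.φ (ψ n) t (hfull (ψ n) ht))) (m ⟨t, ht⟩) := fun t ht n ↦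
    exists_isCoupling_supportMeasure_lintegral_le (ℭ.isometry (ψ n) t _) _ (m ⟨t, ht⟩)
  choose q hqc hqle using hq
  haveI : ∀ t ht n, IsProbabilityMeasure (q t ht n) := fun t ht n ↦ (hqc t ht n).1
  have hcost : ∀ t ht, Tendsto (fun n ↦
      ∫⁻ p, edist (ℭ.φ (ψ n) t (hfull (ψ n) ht) p.1) (p.2 : ℭ.Z ⟨t, ht⟩) ∂q t ht n)
      atTop (𝓝 0) := fun t ht ↦
    tendsto_of_tendsto_of_tendsto_of_le_of_le tendsto_const_nhds
      ((hconv t ht).comp hψ.tendsto_atTop) (fun n ↦ bot_le) (fun n ↦ hqle t ht n)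
  -- STEP 4: `∫ d_{W₁}(kernels n, limit kernels) dqⁿ_t → 0` for `s < t`
  have hδ : ∀ s (hs : s ∈ (↑I₀ : Set ℝ)) t (ht : t ∈ (↑I₀ : Set ℝ)) (hlt : s < t),
      Tendsto (fun n ↦ ∫⁻ p, wassersteinW1
        (((P (φ₁ (ψ n))).flow.condKernel p.1
            ⟨s, (ℭ.dom_subset (ψ n) (hfull (ψ n) hs)).1⟩).map (ℭ.φ (ψ n) s (hfull (ψ n) hs)))
        (K s hs t ht hlt p.2) ∂q t ht n) atTop (𝓝 0) := by
    intro s hs t ht hlt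
    haveI := hKP s hs t ht hlt
    haveI : ∀ n (x : (P (φ₁ (ψ n))).flow.Slice ⟨t, (ℭ.dom_subset (ψ n) (hfull (ψ n) ht)).1⟩),
        IsProbabilityMeasure (((P (φ₁ (ψ n))).flow.condKernel x
          ⟨s, (ℭ.dom_subset (ψ n) (hfull (ψ n) hs)).1⟩).map (ℭ.φ (ψ n) s (hfull (ψ n) hs))) :=
      fun n x ↦ by
      haveI := (P (φ₁ (ψ n))).flow.isProbabilityMeasure_condKernel
        (s := ⟨s, (ℭ.dom_subset (ψ n) (hfull (ψ n) hs)).1⟩) x hlt.le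
      exact Measure.isProbabilityMeasure_map (ℭ.isometry _ _ _).continuous.measurable.aemeasurable
    exact tendsto_lintegral_wassersteinW1_kernel (Zl := ℭ.Z ⟨s, hs⟩) (Zk := ℭ.Z ⟨t, ht⟩)
      (S := (m ⟨t, ht⟩).support)
      (X := fun n ↦ (P (φ₁ (ψ n))).flow.Slice ⟨t, (ℭ.dom_subset (ψ n) (hfull (ψ n) ht)).1⟩)
      Subtype.val isometry_subtype_coe (fun n ↦ ℭ.φ (ψ n) t (hfull (ψ n) ht))
      (fun n ↦ ℭ.isometry _ _ _)
      (fun n x ↦ ((P (φ₁ (ψ n))).flow.condKernel x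
        ⟨s, (ℭ.dom_subset (ψ n) (hfull (ψ n) hs)).1⟩).map (ℭ.φ (ψ n) s (hfull (ψ n) hs)))
      (fun n x x' ↦ (hP _).wassersteinW1_map_condKernel_le_edist hlt.le (ℭ.isometry _ _ _) x x')
      (K s hs t ht hlt) (hKL s hs t ht hlt) (hDd s hs t ht hlt) (hxD s hs t ht hlt)
      (hlim s hs t ht hlt) (supportMeasure (m ⟨t, ht⟩))
      (lintegral_edist_supportMeasure_ne_top (m ⟨t, ht⟩) (hmV ⟨t, ht⟩) (D s hs t ht hlt 0))
      (q t ht) (fun n ↦ (hqc t ht n).2.2) (hcost t ht)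
  -- STEP 5–6: the correspondence along the final subsequence and the glued couplings
  refine ⟨φ₁ ∘ ψ, hφ₁.comp hψ,
    { Z := ℭ.Z
      dom := fun n ↦ ℭ.dom (ψ n)
      dom_subset := fun n ↦ ℭ.dom_subset (ψ n)
      φ := fun n ↦ ℭ.φ (ψ n)
      isometry := fun n ↦ ℭ.isometry (ψ n) }, fun n ↦ hfull (ψ n), fun ε hε ↦ ?_⟩
  have hε2 : 0 < ENNReal.ofReal (ε / 2) := ENNReal.ofReal_pos.2 (half_pos hε)
  -- `N(ε)`: all finitely many error terms are `≤ ε / 2`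
  have hev₁ : ∀ᶠ n in atTop, ∀ t ∈ I₀, ∀ ht : t ∈ (↑I₀ : Set ℝ),
      ∫⁻ p, edist (ℭ.φ (ψ n) t (hfull (ψ n) ht) p.1) (p.2 : ℭ.Z ⟨t, ht⟩) ∂q t ht n ≤
        ENNReal.ofReal (ε / 2) := by
    refine (I₀.eventually_all).2 fun t ht ↦ ?_
    obtain ⟨N, hN⟩ := ENNReal.tendsto_atTop_zero.1 (hcost t ht) _ hε2
    exact eventually_atTop.2 ⟨N, fun n hn _ ↦ hN n hn⟩
  have hev₂ : ∀ᶠ n in atTop, ∀ s ∈ I₀, ∀ t ∈ I₀, ∀ (hs : s ∈ (↑I₀ : Set ℝ))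
      (ht : t ∈ (↑I₀ : Set ℝ)) (hlt : s < t), ∫⁻ p, wassersteinW1
        (((P (φ₁ (ψ n))).flow.condKernel p.1
            ⟨s, (ℭ.dom_subset (ψ n) (hfull (ψ n) hs)).1⟩).map (ℭ.φ (ψ n) s (hfull (ψ n) hs)))
        (K s hs t ht hlt p.2) ∂q t ht n ≤ ENNReal.ofReal (ε / 2) := by
    refine (I₀.eventually_all).2 fun s hs ↦ (I₀.eventually_all).2 fun t ht ↦ ?_
    by_cases hlt : s < t
    · obtain ⟨N, hN⟩ := ENNReal.tendsto_atTop_zero.1 (hδ s hs t ht hlt) _ hε2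
      exact eventually_atTop.2 ⟨N, fun n hn _ _ _ ↦ hN n hn⟩
    · exact Eventually.of_forall fun n _ _ h ↦ absurd h hlt
  obtain ⟨N, hN⟩ := eventually_atTop.1 (hev₁.and hev₂)
  refine ⟨N, fun i hi j hj ↦ ?_⟩
  -- glue `qⁱ_t` and `qʲ_t` along `m_t|_{supp m_t}`
  have hQ : ∀ (t : ℝ) (ht : t ∈ (↑I₀ : Set ℝ)), ∃ Q : Measure
      ((P (φ₁ (ψ i))).flow.Slice ⟨t, (ℭ.dom_subset (ψ i) (hfull (ψ i) ht)).1⟩ ×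
        (P (φ₁ (ψ j))).flow.Slice ⟨t, (ℭ.dom_subset (ψ j) (hfull (ψ j) ht)).1⟩),
      IsCoupling ((P (φ₁ (ψ i))).μ ⟨t, (ℭ.dom_subset (ψ i) (hfull (ψ i) ht)).1⟩)
        ((P (φ₁ (ψ j))).μ ⟨t, (ℭ.dom_subset (ψ j) (hfull (ψ j) ht)).1⟩) Q ∧
      ∀ (F₁ : (P (φ₁ (ψ i))).flow.Slice ⟨t, (ℭ.dom_subset (ψ i) (hfull (ψ i) ht)).1⟩ ×
          (m ⟨t, ht⟩).support → ℝ≥0∞)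
        (F₂ : (P (φ₁ (ψ j))).flow.Slice ⟨t, (ℭ.dom_subset (ψ j) (hfull (ψ j) ht)).1⟩ ×
          (m ⟨t, ht⟩).support → ℝ≥0∞), Measurable F₁ → Measurable F₂ →
        ∀ G : (P (φ₁ (ψ i))).flow.Slice ⟨t, (ℭ.dom_subset (ψ i) (hfull (ψ i) ht)).1⟩ ×
            (P (φ₁ (ψ j))).flow.Slice ⟨t, (ℭ.dom_subset (ψ j) (hfull (ψ j) ht)).1⟩ → ℝ≥0∞,
          (∀ x₁ x₂ y, G (x₁, x₂) ≤ F₁ (x₁, y) + F₂ (x₂, y)) →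
          ∫⁻ p, G p ∂Q ≤ ∫⁻ p, F₁ p ∂q t ht i + ∫⁻ p, F₂ p ∂q t ht j := fun t ht ↦
    (hqc t ht i).exists_glue_lintegral_le (hqc t ht j)
  choose Q hQc hQint using hQ
  obtain ⟨hNi₁, hNi₂⟩ := hN i hi
  obtain ⟨hNj₁, hNj₂⟩ := hN j hj
  have hεε : ENNReal.ofReal (ε / 2) + ENNReal.ofReal (ε / 2) = ENNReal.ofReal ε := by
    rw [← ENNReal.ofReal_add (half_pos hε).le (half_pos hε).le, add_halves]
  refine ⟨hε, MeasurableSet.empty, empty_subset _, fun t ht ↦ ⟨ht, fun h ↦ h⟩,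
    fun t ht ↦ hfull (ψ i) ht.1, fun t ht ↦ hfull (ψ j) ht.1,
    by rw [measure_empty]; exact bot_le, fun t ht ↦ Q t ht.1, fun t ht ↦ hQc t ht.1,
    fun s hs t ht hst ↦ ?_⟩
  rcases hst.eq_or_lt with rfl | hlt
  · -- `s = t`: distances of points, (7.21)
    have hF₁ : Measurable fun p : (P (φ₁ (ψ i))).flow.Slice
        ⟨s, (ℭ.dom_subset (ψ i) (hfull (ψ i) hs.1)).1⟩ × (m ⟨s, hs.1⟩).support ↦
        edist (ℭ.φ (ψ i) s (hfull (ψ i) hs.1) p.1) (p.2 : ℭ.Z ⟨s, hs.1⟩) :=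
      (((ℭ.isometry _ _ _).continuous.comp continuous_fst).edist
        (continuous_subtype_val.comp continuous_snd)).measurable
    have hF₂ : Measurable fun p : (P (φ₁ (ψ j))).flow.Slice
        ⟨s, (ℭ.dom_subset (ψ j) (hfull (ψ j) hs.1)).1⟩ × (m ⟨s, hs.1⟩).support ↦
        edist (ℭ.φ (ψ j) s (hfull (ψ j) hs.1) p.1) (p.2 : ℭ.Z ⟨s, hs.1⟩) :=
      (((ℭ.isometry _ _ _).continuous.comp continuous_fst).edist
        (continuous_subtype_val.comp continuous_snd)).measurable
    refine (hQint s hs.1 _ _ hF₁ hF₂ _ fun x₁ x₂ y ↦ ?_).trans ?_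
    · exact kernelDistWithin_self_le _ _ _ _ _
    · calc _ ≤ ENNReal.ofReal (ε / 2) + ENNReal.ofReal (ε / 2) :=
            add_le_add (hNi₁ s hs.1 hs.1) (hNj₁ s hs.1 hs.1)
        _ = ENNReal.ofReal ε := hεε
  · -- `s < t`: through the limit kernels `K_{s,t}`
    haveI := hKP s hs.1 t ht.1 hlt
    have hF : ∀ k, Measurable fun p : (P (φ₁ (ψ k))).flow.Slice
        ⟨t, (ℭ.dom_subset (ψ k) (hfull (ψ k) ht.1)).1⟩ × (m ⟨t, ht.1⟩).support ↦ wassersteinW1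
        (((P (φ₁ (ψ k))).flow.condKernel p.1
            ⟨s, (ℭ.dom_subset (ψ k) (hfull (ψ k) hs.1)).1⟩).map (ℭ.φ (ψ k) s (hfull (ψ k) hs.1)))
        (K s hs.1 t ht.1 hlt p.2) := by
      intro k
      haveI : ∀ x : (P (φ₁ (ψ k))).flow.Slice ⟨t, (ℭ.dom_subset (ψ k) (hfull (ψ k) ht.1)).1⟩,
          IsProbabilityMeasure (((P (φ₁ (ψ k))).flow.condKernel x
            ⟨s, (ℭ.dom_subset (ψ k) (hfull (ψ k) hs.1)).1⟩).map
              (ℭ.φ (ψ k) s (hfull (ψ k) hs.1))) := fun x ↦ by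
        haveI := (P (φ₁ (ψ k))).flow.isProbabilityMeasure_condKernel
          (s := ⟨s, (ℭ.dom_subset (ψ k) (hfull (ψ k) hs.1)).1⟩) x hlt.le
        exact Measure.isProbabilityMeasure_map (ℭ.isometry _ _ _).continuous.measurable.aemeasurable
      exact measurable_wassersteinW1_kernel
        (fun x ↦ ((P (φ₁ (ψ k))).flow.condKernel x
          ⟨s, (ℭ.dom_subset (ψ k) (hfull (ψ k) hs.1)).1⟩).map (ℭ.φ (ψ k) s (hfull (ψ k) hs.1)))
        (fun x x' ↦ (hP _).wassersteinW1_map_condKernel_le_edist hlt.le (ℭ.isometry _ _ _) x x')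
        (K s hs.1 t ht.1 hlt) (hKL s hs.1 t ht.1 hlt)
    refine (hQint t ht.1 _ _ (hF i) (hF j) _ fun x₁ x₂ y ↦ ?_).trans ?_
    · exact kernelDistWithin_le_add _ _ _ _ _ hlt.le _ _
    · calc _ ≤ ENNReal.ofReal (ε / 2) + ENNReal.ofReal (ε / 2) :=
            add_le_add (hNi₂ s hs.1 t ht.1 hs.1 ht.1 hlt) (hNj₂ s hs.1 t ht.1 hs.1 ht.1 hlt)
        _ = ENNReal.ofReal ε := hεε

end MetricFlowPair

end Literature.Geometry.Riemannian

end
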